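import Mathlib
import HarnessLib
import Literature.Computability.AlgebraicComplexity.NilCoxeterTensor
import Literature.Computability.AlgebraicComplexity.GroupAlgebraTensor
import Literature.Computability.AlgebraicComplexity.TensorRestrictionRank
import Literature.Computability.AlgebraicComplexity.SchoenhageTau
import Literature.Computability.AlgebraicComplexity.FlatteningBound
import Literature.RepresentationTheory.FiniteGroups.WedderburnBlocks
import Literature.RepresentationTheory.FiniteGroups.SymmetricGroupIsotypic
import Literature.Combinatorics.Enumerative.PartitionNumberUpperBound
import Summits.MatrixMultiplication.MatrixMultiplication.Theses.NilCoxeterShadow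
import Summits.MatrixMultiplication.MatrixMultiplication.Theorems.NilCoxeterShadowOmegaTwoGroupAlgebraRank

/-!
# Calibration of the crux `AThesis` (stmt-MatrixMultiplication-0956): for the UNDEGENERATE algebra `ℂ[S_n]`
# the route's thesis is EQUIVALENT to `ω(ℂ) ≠ 2`

Helper file of line `birth`/`registered` (lead cycle 2; lands `--supports stmt-MatrixMultiplication-0956`).
Route `NilCoxeterShadow` bets that the border rank of the structure tensor of the nil-Coxeter algebra
`NC_n = gr ℂ[S_n]` is super-polynomial in `n!` along a subsequence (`AThesis`), and transfers this to
`ω(ℂ) ≠ 2` through the Rees degeneration `bR(T_{NC_n}) ≤ R(T_{ℂ[S_n]})` (`DegenerationTransfer`) and the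
Wedderburn bound `ω = 2 ⇒ R(T_{ℂ[G]}) ≤ C_ε |G|^(1+ε)` (`OmegaTwoGroupAlgebraRank`). This file proves that at
the level of the GROUP algebra nothing is lost and nothing is open:

* `tensorRestrictsTo_groupTensor_matMulTensor_block` — every Wedderburn block `⟨dᵢ,dᵢ,dᵢ⟩` is a
  restriction of `T_{ℂ[G]}` (so `R(⟨dᵢ,dᵢ,dᵢ⟩) ≤ R(T_{ℂ[G]})`);
* `card_blocks_perm_le_card_partition` — `ℂ[S_n]` has at most `p(n)` (number of partitions) blocks
  (block characters are distinct irreducible characters, which for `S_n` are the `χ^μ`, `μ ⊢ n`);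
* `exists_blockDegree_perm` — hence a block of size `D` with `n! ≤ p(n) · D²` (`∑ dᵢ² = n!`);
* `eventually_superlinear_groupAlgebraRank_of_two_lt_omega` — if `ω(ℂ) = 2 + 2δ₀ > 2` then
  `R(T_{ℂ[S_n]}) ≥ D^ω ≥ (n!/p(n))^(1+δ₀) ≥ (n!)^(1+δ₀/2)` for all large `n`
  (`p(n) ≤ e^{π²/6} e^n` by `card_partition_le_exp_add`, and `e^{O(n)} ≤ (n!)^(δ₀/2)` eventually);
* `not_matrixMultiplication_of_io_superlinear_groupAlgebraRank` — conversely (the route's `closes`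
  argument one level up) super-linear `R(T_{ℂ[S_n]})` infinitely often refutes `ω(ℂ) = 2`;
* `superlinear_groupAlgebraRank_iff_not_matrixMultiplication` — **the calibration**:
  `(∃ δ > 0, ∀ᶠ n, (n!)^(1+δ) ≤ R(T_{ℂ[S_n]})) ↔ ¬ MatrixMultiplication`;
* `io_superlinear_groupAlgebraRank_of_aThesis` — and `AThesis` implies the (infinitely-often) group-algebra
  thesis through `bR(T_{NC_n}) ≤ R(T_{ℂ[S_n]})`.

Consequence for planners (honest reading). The chain is
`AThesis ⟹ [i.o. super-linear R(T_{ℂ[S_n]})] ⟹ ω ≠ 2 ⟹ [eventually super-linear R(T_{ℂ[S_n]})]`, and the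
last two are equivalent; so the ENTIRE open content of the crux — in either direction — is whether the
Rees degeneration `ℂ[S_n] ⇝ NC_n` preserves super-linearity of (border) rank along a subsequence:
`AThesis ↔ ¬MM` would follow from (and is morally the same as) "`bR(T_{NC_n}) ≥ R(T_{ℂ[S_n]})^{1-o(1)}`
infinitely often", while `¬AThesis` unconditionally needs `bR(T_{NC_n}) = (n!)^{1+o(1)}` REGARDLESS of `ω`,
i.e. a border-rank upper bound for `NC_n` that does not route through the matrix blocks of `ℂ[S_n]`.
-/

-- `Summit.<Summit>.<Problem>`: for the single-conjunct summit the duplicate component is mandated.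
set_option linter.dupNamespace false

noncomputable section

namespace Summit.MatrixMultiplication.MatrixMultiplication.Theorems.AThesis

open scoped BigOperators
open Filter
open Literature.Computability.AlgebraicComplexity
open Literature.RepresentationTheory.FiniteGroups
open Literature.Combinatorics.Enumerative
open Summit.MatrixMultiplication.MatrixMultiplication.Theses.NilCoxeterShadow

/-! ## Wedderburn blocks are restrictions of the group tensor -/

/-- **Every Wedderburn block is a restriction of the group tensor**: for `φ : ℂ[G] ≃ₐ ∏ᵢ ℂ^{dᵢ×dᵢ}`,
`T_{ℂ[G]} ≥ ⊕ᵢ ⟨dᵢ,dᵢ,dᵢ⟩ ≥ ⟨dᵢ,dᵢ,dᵢ⟩` (isomorphic algebras have restriction-equivalent structure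
tensors; the block algebra's structure tensor in matrix units is the direct sum of matrix multiplication
tensors; a direct summand is a coordinate restriction). [cite: BurgisserClausenShokrollahi1997, Rem. (14.28)] -/
theorem tensorRestrictsTo_groupTensor_matMulTensor_block {G : Type} [Group G] [Fintype G] [DecidableEq G]
    {r : ℕ} {d : Fin r → ℕ} (φ : MonoidAlgebra ℂ G ≃ₐ[ℂ] BlockAlgebraC d) (i : Fin r) :
    TensorRestrictsTo (groupTensor ℂ G) (matMulTensor ℂ (d i) (d i) (d i)) := by
  -- `T_{ℂ[G]} ≥ T_{∏ M_{dᵢ}} = ⊕ᵢ ⟨dᵢ,dᵢ,dᵢ⟩`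
  have h1 : TensorRestrictsTo (groupTensor ℂ G) (matMulDirectSum ℂ d d d) := by
    have h := structureTensor_restrictsTo_of_algEquiv (blockBasis ℂ d) (MonoidAlgebra.basis G ℂ) φ.symm
    rwa [groupTensor_eq_structureTensor, structureTensor_blockBasis_eq_matMulDirectSum] at h
  -- `⊕ᵢ ⟨dᵢ,dᵢ,dᵢ⟩ ≥ ⟨dᵢ,dᵢ,dᵢ⟩` (coordinate restriction to block `i`)
  have h2 : TensorRestrictsTo (matMulDirectSum ℂ d d d) (matMulTensor ℂ (d i) (d i) (d i)) := by
    have e : (fun a b c : Fin (d i) × Fin (d i) =>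
        matMulDirectSum ℂ d d d (⟨i, a⟩ : Σ j : Fin r, Fin (d j) × Fin (d j))
          (⟨i, b⟩ : Σ j : Fin r, Fin (d j) × Fin (d j)) (⟨i, c⟩ : Σ j : Fin r, Fin (d j) × Fin (d j))) =
        matMulTensor ℂ (d i) (d i) (d i) := by
      funext a b c
      exact matMulDirectSum_block ℂ d d d i a b c
    rw [← e]
    exact tensorRestrictsTo_precomp (matMulDirectSum ℂ d d d)
      (fun a : Fin (d i) × Fin (d i) => (⟨i, a⟩ : Σ j : Fin r, Fin (d j) × Fin (d j)))
      (fun b : Fin (d i) × Fin (d i) => (⟨i, b⟩ : Σ j : Fin r, Fin (d j) × Fin (d j)))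
      (fun c : Fin (d i) × Fin (d i) => (⟨i, c⟩ : Σ j : Fin r, Fin (d j) × Fin (d j)))
  exact h1.trans h2

/-- `R(⟨dᵢ,dᵢ,dᵢ⟩) ≤ R(T_{ℂ[G]})` for every Wedderburn block. [cite: BurgisserClausenShokrollahi1997, Prop. (14.23)] -/
theorem tensorRank_matMulTensor_block_le {G : Type} [Group G] [Fintype G] [DecidableEq G]
    {r : ℕ} {d : Fin r → ℕ} (φ : MonoidAlgebra ℂ G ≃ₐ[ℂ] BlockAlgebraC d) (i : Fin r) :
    tensorRank (matMulTensor ℂ (d i) (d i) (d i)) ≤ tensorRank (groupTensor ℂ G) :=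
  (tensorRestrictsTo_groupTensor_matMulTensor_block φ i).tensorRank_le

/-! ## `ℂ[S_n]` has at most `p(n)` blocks, hence a block of size `≥ √(n!/p(n))` -/

/-- **`ℂ[S_n]` has at most `p(n)` Wedderburn blocks**: the block characters are pairwise distinct
irreducible characters (`character_blockRep_injective`), and the irreducible characters of `S_n` are the
`χ^μ`, `μ ⊢ n` (`irrChars_perm_eq`). [cite: CohnUmans2003, §1.3] -/
theorem card_blocks_perm_le_card_partition {n r : ℕ} {d : Fin r → ℕ} (hd : ∀ i, NeZero (d i))
    (φ : MonoidAlgebra ℂ (Equiv.Perm (Fin n)) ≃ₐ[ℂ] BlockAlgebraC d) :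
    r ≤ Fintype.card (Nat.Partition n) := by
  set χ : Fin r → (Equiv.Perm (Fin n) → ℂ) := fun i => (blockRep φ i).character with hχ
  have hinj : Function.Injective χ := character_blockRep_injective φ
  have hmem : ∀ i, χ i ∈ irrChars (Equiv.Perm (Fin n)) := fun i =>
    ⟨Fin (d i) → ℂ, inferInstance, inferInstance, inferInstance, blockRep φ i,
      isIrreducible_blockRep φ i, rfl⟩
  simp only [irrChars_perm_eq, Set.mem_range] at hmem
  choose f hf using hmem
  have hfinj : Function.Injective f := fun i j hij => hinj (by rw [← hf i, ← hf j, hij])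
  simpa using Fintype.card_le_of_injective f hfinj

/-- **A large block of `ℂ[S_n]`**: there is `D` with `n! ≤ p(n) · D²` and `R(⟨D,D,D⟩) ≤ R(T_{ℂ[S_n]})`
(the largest block: `n! = ∑ᵢ dᵢ² ≤ r · D² ≤ p(n) · D²`). [folklore] -/
theorem exists_blockDegree_perm (n : ℕ) :
    ∃ D : ℕ, n.factorial ≤ Fintype.card (Nat.Partition n) * D ^ 2 ∧
      tensorRank (matMulTensor ℂ D D D) ≤ tensorRank (groupTensor ℂ (Equiv.Perm (Fin n))) := by
  obtain ⟨r, d, hd, ⟨φ⟩⟩ := exists_algEquiv_pi_matrix (Equiv.Perm (Fin n))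
  haveI := hd
  have hsum : ∑ i, d i ^ 2 = n.factorial := by
    rw [sum_sq_blockDegrees_eq_card φ, Nat.card_eq_fintype_card, Fintype.card_perm, Fintype.card_fin]
  have hr : r ≤ Fintype.card (Nat.Partition n) := card_blocks_perm_le_card_partition hd φ
  -- `r ≥ 1` (else `n! = 0`)
  have hne : (Finset.univ : Finset (Fin r)).Nonempty := by
    rw [Finset.univ_nonempty_iff]
    by_contra h
    rw [not_nonempty_iff] at h
    have : ∑ i, d i ^ 2 = 0 := Finset.sum_eq_zero fun i _ => (IsEmpty.false i).elim
    rw [hsum] at this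
    exact Nat.factorial_ne_zero n this
  obtain ⟨i₀, -, hi₀⟩ := Finset.exists_mem_eq_sup Finset.univ hne d
  refine ⟨d i₀, ?_, tensorRank_matMulTensor_block_le φ i₀⟩
  calc n.factorial = ∑ i, d i ^ 2 := hsum.symm
    _ ≤ ∑ _i : Fin r, d i₀ ^ 2 := Finset.sum_le_sum fun i _ =>
        Nat.pow_le_pow_left (hi₀ ▸ Finset.le_sup (Finset.mem_univ i)) 2
    _ = r * d i₀ ^ 2 := by rw [Finset.sum_const, Finset.card_univ, Fintype.card_fin, smul_eq_mul]
    _ ≤ Fintype.card (Nat.Partition n) * d i₀ ^ 2 := Nat.mul_le_mul_right _ hr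

/-! ## Exponentials are eventually below any power of the factorial -/

/-- For `A, a > 0` and `η > 0`: `A · aⁿ ≤ (n!)^η` for all large `n` (from Mathlib's
`A' · a'ⁿ < n!` eventually, at `A' = A^(1/η)`, `a' = a^(1/η)`, raised to the power `η`). [folklore] -/
theorem eventually_const_mul_pow_le_factorial_rpow {A a η : ℝ} (hA : 0 < A) (ha : 0 < a) (hη : 0 < η) :
    ∀ᶠ n : ℕ in atTop, A * a ^ n ≤ (n.factorial : ℝ) ^ η := by
  have hev := FloorSemiring.eventually_mul_pow_lt_factorial_sub (A ^ (1 / η)) (a ^ (1 / η)) 0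
  filter_upwards [hev] with n hn
  rw [Nat.sub_zero] at hn
  have hA' : 0 < A ^ (1 / η) := Real.rpow_pos_of_pos hA _
  have ha' : 0 < a ^ (1 / η) := Real.rpow_pos_of_pos ha _
  have hprod : 0 ≤ A ^ (1 / η) * (a ^ (1 / η)) ^ n := by positivity
  have h1 : (A ^ (1 / η) * (a ^ (1 / η)) ^ n) ^ η ≤ (n.factorial : ℝ) ^ η :=
    Real.rpow_le_rpow hprod hn.le hη.le
  have hηinv : (1 / η) * η = 1 := by field_simp
  have hAA : (A ^ (1 / η)) ^ η = A := by rw [← Real.rpow_mul hA.le, hηinv, Real.rpow_one]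
  have haa' : (a ^ (1 / η)) ^ η = a := by rw [← Real.rpow_mul ha.le, hηinv, Real.rpow_one]
  have haa : ((a ^ (1 / η)) ^ n) ^ η = a ^ n := by
    rw [← Real.rpow_natCast (a ^ (1 / η)) n, ← Real.rpow_mul ha'.le, mul_comm (n : ℝ) η,
      Real.rpow_mul ha'.le, haa', Real.rpow_natCast]
  rw [Real.mul_rpow hA'.le (by positivity), hAA, haa] at h1
  exact h1

/-! ## The calibration -/

/-- **`ω(ℂ) > 2` makes `R(T_{ℂ[S_n]})` super-linear, eventually.** If `ω = 2 + 2δ₀` with `δ₀ > 0`, then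
for all large `n`: `R(T_{ℂ[S_n]}) ≥ R(⟨D,D,D⟩) ≥ D^ω = (D²)^(1+δ₀) ≥ (n!/p(n))^(1+δ₀) ≥ (n!)^(1+δ₀/2)`, where
`D` is the largest Wedderburn block (`n! ≤ p(n) D²`), `D^ω ≤ R(⟨D,D,D⟩)` (`ω ≤ log_D R(⟨D,D,D⟩)`), and
`p(n)^(1+δ₀) ≤ (e^{π²/6} eⁿ)^(1+δ₀) ≤ (n!)^(δ₀/2)` eventually. [folklore] -/
theorem eventually_superlinear_groupAlgebraRank_of_two_lt_omega (hω : 2 < omega ℂ) :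
    ∃ δ : ℝ, 0 < δ ∧ ∀ᶠ n : ℕ in atTop,
      (n.factorial : ℝ) ^ (1 + δ) ≤ (tensorRank (groupTensor ℂ (Equiv.Perm (Fin n))) : ℝ) := by
  set δ₀ : ℝ := (omega ℂ - 2) / 2 with hδ₀
  have hδ₀pos : 0 < δ₀ := by rw [hδ₀]; linarith
  have hω' : omega ℂ = 2 * (1 + δ₀) := by rw [hδ₀]; ring
  refine ⟨δ₀ / 2, by positivity, ?_⟩
  -- the partition bound `p(n) ≤ A₀ · a₀ⁿ`, `A₀ = e^{π²/6}`, `a₀ = e`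
  set A₀ : ℝ := Real.exp (Real.pi ^ 2 / 6) with hA₀
  set a₀ : ℝ := Real.exp 1 with ha₀
  have hA₀pos : 0 < A₀ := Real.exp_pos _
  have ha₀pos : 0 < a₀ := Real.exp_pos _
  have hpart : ∀ n : ℕ, (Fintype.card (Nat.Partition n) : ℝ) ≤ A₀ * a₀ ^ n := fun n => by
    have h := card_partition_le_exp_add one_pos n
    have he : Real.exp (n * 1 + Real.pi ^ 2 / (6 * 1)) = A₀ * a₀ ^ n := by
      rw [Real.exp_add, Real.exp_nat_mul, mul_one, hA₀, ha₀, mul_comm]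
    rwa [he] at h
  -- two eventual inequalities: `(A₀ a₀ⁿ)^(1+δ₀) ≤ (n!)^(δ₀/2)` and `4 A₀ a₀ⁿ ≤ n!`
  have hev1 : ∀ᶠ n : ℕ in atTop, A₀ ^ (1 + δ₀) * (a₀ ^ (1 + δ₀)) ^ n ≤ (n.factorial : ℝ) ^ (δ₀ / 2) :=
    eventually_const_mul_pow_le_factorial_rpow (Real.rpow_pos_of_pos hA₀pos _)
      (Real.rpow_pos_of_pos ha₀pos _) (by positivity)
  have hev2 : ∀ᶠ n : ℕ in atTop, 4 * A₀ * a₀ ^ n ≤ (n.factorial : ℝ) ^ (1 : ℝ) :=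
    eventually_const_mul_pow_le_factorial_rpow (by positivity) ha₀pos one_pos
  filter_upwards [hev1, hev2] with n h1 h2
  rw [Real.rpow_one] at h2
  obtain ⟨D, hD, hRD⟩ := exists_blockDegree_perm n
  have hfpos : (0 : ℝ) < (n.factorial : ℝ) := by exact_mod_cast n.factorial_pos
  have hppos : (0 : ℝ) < (Fintype.card (Nat.Partition n) : ℝ) := by
    exact_mod_cast Fintype.card_pos
  set P : ℝ := A₀ * a₀ ^ n with hP
  have hPpos : 0 < P := by positivity
  have hpP : (Fintype.card (Nat.Partition n) : ℝ) ≤ P := hpart n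
  -- `n! ≤ p(n) D² ≤ P D²`
  have hD' : (n.factorial : ℝ) ≤ P * (D : ℝ) ^ 2 := by
    calc (n.factorial : ℝ) ≤ (Fintype.card (Nat.Partition n) : ℝ) * (D : ℝ) ^ 2 := by
          exact_mod_cast hD
      _ ≤ P * (D : ℝ) ^ 2 := mul_le_mul_of_nonneg_right hpP (by positivity)
  -- `D ≥ 2`: otherwise `n! ≤ P < n!/4`
  have hD2 : 2 ≤ D := by
    by_contra hlt
    have hD1 : (D : ℝ) ^ 2 ≤ 1 := by
      have : D ≤ 1 := by omega
      have : (D : ℝ) ≤ 1 := by exact_mod_cast this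
      nlinarith [Nat.cast_nonneg (α := ℝ) D]
    have : (n.factorial : ℝ) ≤ P := hD'.trans (by nlinarith)
    linarith
  -- `R(T_{ℂ[S_n]}) ≥ R(⟨D,D,D⟩) ≥ D^ω = (D²)^(1+δ₀)`
  have hR : ((D : ℝ) ^ 2) ^ (1 + δ₀) ≤ (tensorRank (groupTensor ℂ (Equiv.Perm (Fin n))) : ℝ) := by
    have h := rpow_omega_le_tensorRank_matMulTensor ℂ hD2
    have hD0 : (0 : ℝ) ≤ D := Nat.cast_nonneg _
    have heq : (D : ℝ) ^ omega ℂ = ((D : ℝ) ^ 2) ^ (1 + δ₀) := by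
      rw [hω', Real.rpow_mul hD0, Real.rpow_two]
    rw [heq] at h
    exact h.trans (by exact_mod_cast hRD)
  -- `(D²)^(1+δ₀) ≥ (n!/P)^(1+δ₀) = (n!)^(1+δ₀) / P^(1+δ₀)`
  have hquot : (n.factorial : ℝ) / P ≤ (D : ℝ) ^ 2 := by
    rw [div_le_iff₀ hPpos, mul_comm]
    exact hD'
  have hpow : ((n.factorial : ℝ) / P) ^ (1 + δ₀) ≤ ((D : ℝ) ^ 2) ^ (1 + δ₀) :=
    Real.rpow_le_rpow (by positivity) hquot (by positivity)
  have hsplit : ((n.factorial : ℝ) / P) ^ (1 + δ₀) = (n.factorial : ℝ) ^ (1 + δ₀) / P ^ (1 + δ₀) :=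
    Real.div_rpow hfpos.le hPpos.le _
  -- `P^(1+δ₀) = A₀^(1+δ₀) (a₀^(1+δ₀))ⁿ ≤ (n!)^(δ₀/2)`
  have hPpow : P ^ (1 + δ₀) = A₀ ^ (1 + δ₀) * (a₀ ^ (1 + δ₀)) ^ n := by
    rw [hP, Real.mul_rpow hA₀pos.le (by positivity)]
    congr 1
    rw [← Real.rpow_natCast a₀ n, ← Real.rpow_mul ha₀pos.le, mul_comm (n : ℝ) (1 + δ₀),
      Real.rpow_mul ha₀pos.le, Real.rpow_natCast]
  have hPle : P ^ (1 + δ₀) ≤ (n.factorial : ℝ) ^ (δ₀ / 2) := by rw [hPpow]; exact h1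
  have hPpowpos : 0 < P ^ (1 + δ₀) := Real.rpow_pos_of_pos hPpos _
  -- assemble
  have hexp : (1 + δ₀) - δ₀ / 2 = 1 + δ₀ / 2 := by ring
  calc (n.factorial : ℝ) ^ (1 + δ₀ / 2)
      = (n.factorial : ℝ) ^ (1 + δ₀) / (n.factorial : ℝ) ^ (δ₀ / 2) := by
        rw [← hexp, Real.rpow_sub hfpos]
    _ ≤ (n.factorial : ℝ) ^ (1 + δ₀) / P ^ (1 + δ₀) :=
        div_le_div_of_nonneg_left (Real.rpow_nonneg hfpos.le _) hPpowpos hPle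
    _ = ((n.factorial : ℝ) / P) ^ (1 + δ₀) := hsplit.symm
    _ ≤ ((D : ℝ) ^ 2) ^ (1 + δ₀) := hpow
    _ ≤ (tensorRank (groupTensor ℂ (Equiv.Perm (Fin n))) : ℝ) := hR

/-- **`ω(ℂ) ≠ 2` makes `R(T_{ℂ[S_n]})` super-linear, eventually** (`ω ≥ 2` always, `omega_two_le`).
[folklore] -/
theorem eventually_superlinear_groupAlgebraRank_of_not_matrixMultiplication
    (hMM : ¬ _root_.MatrixMultiplication) :
    ∃ δ : ℝ, 0 < δ ∧ ∀ᶠ n : ℕ in atTop,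
      (n.factorial : ℝ) ^ (1 + δ) ≤ (tensorRank (groupTensor ℂ (Equiv.Perm (Fin n))) : ℝ) := by
  refine eventually_superlinear_groupAlgebraRank_of_two_lt_omega ?_
  have h2 : 2 ≤ omega ℂ := omega_two_le ℂ
  have hne : omega ℂ ≠ 2 := fun h => hMM (MatrixMultiplication_iff.mpr h)
  exact lt_of_le_of_ne h2 (Ne.symm hne)

/-- **Super-linear `R(T_{ℂ[S_n]})` infinitely often refutes `ω(ℂ) = 2`** — the route's `closes` argument
one level up (no degeneration): at `ε = δ/2`, `(n!)^(1+δ) ≤ R(T_{ℂ[S_n]}) ≤ C (n!)^(1+δ/2)` infinitely often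
forces `(n!)^(δ/2) ≤ C` infinitely often, absurd. Uses the landed support item `OmegaTwoGroupAlgebraRank`
(`omegaTwoGroupAlgebraRank_proof`). [folklore] -/
theorem not_matrixMultiplication_of_io_superlinear_groupAlgebraRank
    (h : ∃ δ : ℝ, 0 < δ ∧ ∀ n₀ : ℕ, ∃ n : ℕ, n₀ ≤ n ∧
      (n.factorial : ℝ) ^ (1 + δ) ≤ (tensorRank (groupTensor ℂ (Equiv.Perm (Fin n))) : ℝ)) :
    ¬ _root_.MatrixMultiplication := by
  intro hMM
  obtain ⟨δ, hδ, hinf⟩ := h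
  obtain ⟨C, hC⟩ := Summit.MatrixMultiplication.MatrixMultiplication.Theorems.omegaTwoGroupAlgebraRank_proof
    hMM (δ / 2) (by linarith)
  have hMpos : 0 < max C 1 := lt_of_lt_of_le one_pos (le_max_right _ _)
  obtain ⟨N, hN⟩ := exists_nat_gt ((max C 1) ^ (2 / δ))
  obtain ⟨n, hNn, hn⟩ := hinf N
  have h2 := hC (Equiv.Perm (Fin n))
  rw [Fintype.card_perm, Fintype.card_fin] at h2
  have h3 : (n.factorial : ℝ) ^ (1 + δ) ≤ C * (n.factorial : ℝ) ^ (1 + δ / 2) := hn.trans h2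
  have hfpos : (0 : ℝ) < (n.factorial : ℝ) := by exact_mod_cast n.factorial_pos
  rw [show (1 + δ) = δ / 2 + (1 + δ / 2) by ring, Real.rpow_add hfpos] at h3
  have h4 : (n.factorial : ℝ) ^ (δ / 2) ≤ C :=
    le_of_mul_le_mul_right h3 (Real.rpow_pos_of_pos hfpos _)
  have h5 : (N : ℝ) ≤ (n.factorial : ℝ) := by exact_mod_cast hNn.trans n.self_le_factorial
  have h6 : max C 1 < (N : ℝ) ^ (δ / 2) := by
    have hδ2 : (2 / δ) * (δ / 2) = 1 := by field_simp
    have : ((max C 1) ^ (2 / δ)) ^ (δ / 2) = max C 1 := by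
      rw [← Real.rpow_mul hMpos.le, hδ2, Real.rpow_one]
    calc max C 1 = ((max C 1) ^ (2 / δ)) ^ (δ / 2) := this.symm
      _ < (N : ℝ) ^ (δ / 2) := Real.rpow_lt_rpow (Real.rpow_nonneg hMpos.le _) hN (by positivity)
  have h7 : (N : ℝ) ^ (δ / 2) ≤ (n.factorial : ℝ) ^ (δ / 2) :=
    Real.rpow_le_rpow (Nat.cast_nonneg _) h5 (by positivity)
  linarith [le_max_left C 1]

/-- **THE CALIBRATION.** For the undegenerate algebra the route's thesis is equivalent to the negation of
the summit: `(∃ δ > 0, ∀ᶠ n, (n!)^(1+δ) ≤ R(T_{ℂ[S_n]})) ↔ ¬ MatrixMultiplication` (`ω(ℂ) ≠ 2`).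
[folklore] -/
theorem superlinear_groupAlgebraRank_iff_not_matrixMultiplication :
    (∃ δ : ℝ, 0 < δ ∧ ∀ᶠ n : ℕ in Filter.atTop, (n.factorial : ℝ) ^ (1 + δ) ≤ (Literature.Computability.AlgebraicComplexity.tensorRank (Literature.Computability.AlgebraicComplexity.groupTensor ℂ (Equiv.Perm (Fin n))) : ℝ)) ↔ ¬ _root_.MatrixMultiplication := by
  constructor
  · rintro ⟨δ, hδ, hev⟩
    refine not_matrixMultiplication_of_io_superlinear_groupAlgebraRank ⟨δ, hδ, fun n₀ => ?_⟩
    obtain ⟨N, hN⟩ := Filter.eventually_atTop.mp hev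
    exact ⟨max N n₀, le_max_right _ _, hN _ (le_max_left _ _)⟩
  · exact eventually_superlinear_groupAlgebraRank_of_not_matrixMultiplication

/-- **`AThesis` implies the (infinitely-often) group-algebra thesis**, through the Rees degeneration
`bR(T_{NC_n}) ≤ R(T_{ℂ[S_n]})` (`algBorderRank_nilCoxeterTensor_le`). Together with the calibration:
`AThesis ⟹ [i.o. super-linear R(T_{ℂ[S_n]})] ⟹ ω ≠ 2 ⟺ [eventually super-linear R(T_{ℂ[S_n]})]` — the open
content of the crux is exactly the degeneration gap `ℂ[S_n] ⇝ NC_n`. [folklore] -/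
theorem io_superlinear_groupAlgebraRank_of_aThesis (h : AThesis) :
    ∃ δ : ℝ, 0 < δ ∧ ∀ n₀ : ℕ, ∃ n : ℕ, n₀ ≤ n ∧
      (n.factorial : ℝ) ^ (1 + δ) ≤ (tensorRank (groupTensor ℂ (Equiv.Perm (Fin n))) : ℝ) := by
  have h' : ∃ δ : ℝ, 0 < δ ∧ ∀ n₀ : ℕ, ∃ n : ℕ, n₀ ≤ n ∧
      (n.factorial : ℝ) ^ (1 + δ) ≤ (algBorderRank (nilCoxeterTensor ℂ n) : ℝ) := h
  obtain ⟨δ, hδ, hio⟩ := h'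
  refine ⟨δ, hδ, fun n₀ => ?_⟩
  obtain ⟨n, hn, hle⟩ := hio n₀
  refine ⟨n, hn, hle.trans ?_⟩
  exact_mod_cast algBorderRank_nilCoxeterTensor_le ℂ n

end Summit.MatrixMultiplication.MatrixMultiplication.Theorems.AThesis

end
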